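import Summits.BirchSwinnertonDyer.BirchSwinnertonDyer.Theorems.SemiOrdinaryEisensteinDescentWildSigmaDivisibilityAtThreeMultiCarrierCremonaRange
import Summits.BirchSwinnertonDyer.BirchSwinnertonDyer.Theorems.SchneiderFreeAdditiveX3PoitouTateReciprocitySumHolds
import HarnessLib

/-!
# Crux J‴ `WildSigmaDivisibilityAtThreeMultiCarrier` (stmt-BirchSwinnertonDyer-25898), line `birth`: the Poitou–Tate conjunct of
# `stub_printConj` DISCHARGED — J‴ BY NAME ⟸ E0 + Gross 3.7 (2) + `stub_maninThree` + `stub_flatMultiCarrier`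
# (route `SemiOrdinaryEisensteinDescent`; width seat `bsd-wall-soed-p2-w3` g6; `--supports stmt-BirchSwinnertonDyer-25898`, helper)

EVENT (2026-08-28T10:21Z). Cell bsd-schneider's Route A landed Poitou–Tate duality for Selmer structures for EVERY number field
(`SchneiderFreeAdditiveX3.PoitouTateReduction.poitouTate_selmerStructure_duality_holds`, p624636) and — its corollary for THE canonical
local invariant maps — Howard's complement property `(LocalInvariants.canonical K n).SelmerComplement` at every `K`, `n`
(`selmerComplement_canonical_holds`, p626891). With w2 g6's reduction (`JetchevMaxDivisibilityAtThreeModThreeOfMiddleExact`: IsPerfect,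
reciprocity, Milne I 2.6 and the conjugation compatibility of THE maps are kernel theorems) the FIVE-conjunct fact
`poitouTate_selmerStructure_duality_conj K` (item 23092's body; the first conjunct of the line's `stub_printConj`) is a theorem for
every `K`, so the skeleton of record (Lines/birth.lean v2, 07b0d11c6f7be939) loses one print conjunct:

* `wildSigmaDivisibilityAtThreeMultiCarrier_of_flatMultiCarrier_of_maninThree_of_twoPrintFacts` — **J‴ BY NAME ⟸ E0 + 3.7 (2) +
  `stub_maninThree` + `stub_flatMultiCarrier`** (= p621905's v2 composition with `hPT` discharged) — the body of skeleton v3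
  (`stub_printConj := E0 ∧ 3.7 (2)`);
* `sigma_at_of_twoPrintFacts_of_flatMultiCarrier_of_level_le_500000` — on Cremona's range `N ≤ 500000` (⊇ every census class of
  row 2·3@3) J‴'s conclusion at every frame ⟸ E0 + 3.7 (2) + Cremona + `stub_flatMultiCarrier` (p621905 §2 with `hPT` discharged);
* `jetchevMaxModThree_of_twoPrintFacts` — Jetchev's max-form σ-divisibility at `3 ∣ N` under `ρ̄₃` onto (the consequent of item 25897
  `JetchevMaxDivisibilityAtThreeModThree`) ⟸ E0 + 3.7 (2) ONLY.

So after this file the Kolyvagin column's inputs BY NAME are: research `stub_flatMultiCarrier` (tight: ⟸ leaf + Z + print, p623556) ⊕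
Manin₃ off Cremona's range ⊕ PRINT {Gross 1991 E0 (GZ86 III (3.1)), Gross 1991 Prop. 3.7 (2), Cremona's table}; the duality input is
GONE. CONDITIONAL theorems; nothing is asserted about any curve unconditionally; BSD is not proved by any of this; no case of Poitou–Tate
duality is proved IN THIS FILE (it is consumed by name from cell bsd-schneider's files).

References: [cite: Jetchev2008, Thm. 1.4, Rem. 1.2 and Conj. 1.3 (p. 812)] [cite: Buyukboduk2009TamagawaDefect, §4.2 Question 1]
[cite: MilneADT2006, Ch. I, Cor. 2.3, Thm. 2.6, Thm. 4.10(b)] [cite: Howard2004HeegnerKolyvagin, Thm. 2.1.11 (arXiv:1202.6340 p. 6)]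
[cite: GrossLMS1991, Prop. 3.7 (2) and §6] [cite: AgasheRibetStein2006, §2 and Thm. 2.7] [cite: CesnaviciusNeururerSaha2023, §1 p. 574 and ref. [Cre22]]
-/

set_option autoImplicit false
set_option linter.dupNamespace false

noncomputable section

open scoped Classical

namespace Summit.BirchSwinnertonDyer.BirchSwinnertonDyer.Theorems.WildSigmaDivisibilityAtThreeMultiCarrierOfTwoPrintFacts

open WeierstrassCurve NumberField IsDedekindDomain Literature.NumberTheory.EllipticCurves
  Literature.NumberTheory.EllipticCurves.ModularForms
  Literature.NumberTheory.GaloisRepresentations Literature.NumberTheory.GaloisCohomology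
  Summit.BirchSwinnertonDyer.Rank1Residual
  Summit.BirchSwinnertonDyer.Rank1Residual.Additive
  Summit.BirchSwinnertonDyer.Rank1Residual.X11b.Three
  Summit.BirchSwinnertonDyer.BirchSwinnertonDyer.Theses.SemiOrdinaryEisensteinDescent
  Summit.BirchSwinnertonDyer.BirchSwinnertonDyer.Theorems.WildKolyvaginUpperAtThreeTowerFreeJetchevMaxModThree
  Summit.BirchSwinnertonDyer.BirchSwinnertonDyer.Theorems.WildSigmaDivisibilityAtThreeMultiCarrierCremonaRange
  Summit.BirchSwinnertonDyer.BirchSwinnertonDyer.Theorems.JetchevMaxDivisibilityAtThreeModThreeOfMiddleExact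
  Summit.BirchSwinnertonDyer.BirchSwinnertonDyer.Theorems.SchneiderFreeAdditiveX3.PoitouTateReduction
open Literature.NumberTheory.EllipticCurves.GrossLMS1991 (prop37_2_frobeniusCongruence)

/-! ## §0 The five-conjunct duality fact at every number field, from the canonical family's complement property -/

/-- **`poitouTate_selmerStructure_duality_conj K` for every number field `K` ⟸ `(LocalInvariants.canonical K n).SelmerComplement`
for every `K`, `n`** — IsPerfect (`canonical_isPerfect`), reciprocity and conjugation compatibility of THE maps being kernel theorems
(`poitouTate_selmerStructure_duality_conj_of_canonical_numberField`) and Milne I Thm. 2.6 a consequence of IsPerfect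
(`unramifiedOrthogonal_of_isPerfect_allLevels`). Same term as inside w2 g6's `…_of_selmerComplementCanonical`; stated for reuse below.
[cite: MilneADT2006, Ch. I, Cor. 2.3, Thm. 2.6, Thm. 4.10(b)] [cite: Howard2004HeegnerKolyvagin, Thm. 2.1.11 (arXiv:1202.6340 p. 6)] -/
theorem poitouTate_conj_of_selmerComplementCanonical (K : Type) [Field K] [NumberField K]
    (hSC : ∀ (n : ℕ) [NeZero n], (LocalInvariants.canonical K n).SelmerComplement) :
    poitouTate_selmerStructure_duality_conj K :=
  poitouTate_selmerStructure_duality_conj_of_canonical_numberField K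
    (fun n _ ↦ unramifiedOrthogonal_of_isPerfect_allLevels (LocalInvariants.canonical K n) LocalInvariants.canonical_isPerfect) hSC

/-! ## §1 Jetchev's max-form mod 3 from E0 + 3.7 (2) -/

/-- **Jetchev's max-form σ-divisibility at `3 ∣ N` under `ρ̄₃` onto — the consequent of item `JetchevMaxDivisibilityAtThreeModThree`
(stmt-25897) — ⟸ Gross 1991 E0 + Prop. 3.7 (2)** and the canonical family's complement property (`hSC`): on every odd-`d_K` Heegner
frame of the wild cell and every `q ∣ N` the Kolyvagin points are `3`-divisible to depth `ord₃ c_q(E/ℚ_q)` (`Koly.PDiv`). =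
`jetchevMaxModThree_of_literature` (p606426, Jetchev Thm. 1.4 / Thm. 5.1 sign by sign) with its duality input fed by §0.
[cite: Jetchev2008, Thm. 1.4 (p. 812), Thm. 5.1] [cite: GrossLMS1991, Prop. 3.7 (2) and §6] -/
theorem jetchevMaxModThree_of_twoPrintFacts_of_selmerComplementCanonical
    (hSC : ∀ (K : Type) [Field K] [NumberField K] (n : ℕ) [NeZero n], (LocalInvariants.canonical K n).SelmerComplement)
    (hE0 : Gross1991_heegnerPoint_sub_ratTorsion_mem_E0) (h372 : prop37_2_frobeniusCongruence) :
    ∀ (W : WeierstrassCurve ℚ) [W.IsElliptic] [W.IsGloballyMinimal] (N : ℕ) [NeZero N] (K : Type) [Field K] [NumberField K]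
      (Dt : ModularParametrizationData W N) (H : HeegnerDatum N (NumberField.discr K)) (ι : K →+* ℂ)
      (P : (W.baseChange K).toAffine.Point),
      ClassO6 W 3 → W.HasSurjectiveModNGaloisRep 3 → W.analyticRank = 1 → W.conductorNorm ℤ = N →
      IsImaginaryQuadratic K → SatisfiesHeegnerHypothesis N K →
      (W.quadraticTwist (NumberField.discr K : ℚ)).entireLFunction 1 ≠ 0 →
      WeierstrassCurve.Affine.Point.map ι.toRatAlgHom P = heegnerPointComplex Dt H →
      ¬ IsOfFinAddOrder P → Odd (NumberField.discr K) → NumberField.discr K ≠ -3 →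
      ∀ (q : ℕ) [Fact q.Prime], q ∣ N →
        ∀ (s' : ℕ), s' ≤ padicValNat 3 ((W.baseChange ℚ_[q]).localTamagawaNumber ℤ_[q]) →
          ∀ (n : ℕ) (d : KolyvaginHeegnerData Dt H.β ι n), Squarefree n →
            (∀ ℓ ∈ n.primeFactors, Zhang2014.IsKolyvaginPrime N W K 3 ℓ ∧ s' ≤ Zhang2014.kolyvaginIndex W 3 ℓ) →
              Koly.PDiv d 3 s' :=
  (jetchevMaxDivisibilityAtThreeModThree_of_selmerComplementCanonical hSC)
    (fun K _ _ ↦ poitouTate_selmerStructure_duality_of_conj (poitouTate_conj_of_selmerComplementCanonical K (hSC K))) hE0 h372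

/-! ## §2 J‴ BY NAME from two print facts + the two remaining stubs -/

/-- **J‴ (25898) BY NAME ⟸ E0 + 3.7 (2) + `stub_maninThree` (`hM3`) + `stub_flatMultiCarrier` (`hJmF`)** and the canonical family's
complement property (`hSC`) — p621905's skeleton-v2 composition
`wildSigmaDivisibilityAtThreeMultiCarrier_of_flatMultiCarrier_of_maninThree_of_threePrintFacts` with its `hPT` binder fed by §0.
CONDITIONAL; nothing asserted. [cite: Jetchev2008, Thm. 1.4 and Conj. 1.3 (p. 812)] [cite: Buyukboduk2009TamagawaDefect, §4.2 Question 1]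
[cite: AgasheRibetStein2006, §2 and Thm. 2.7] -/
theorem wildSigmaDivisibilityAtThreeMultiCarrier_of_flatMultiCarrier_of_maninThree_of_twoPrintFacts_of_selmerComplementCanonical
    (hSC : ∀ (K : Type) [Field K] [NumberField K] (n : ℕ) [NeZero n], (LocalInvariants.canonical K n).SelmerComplement)
    (hE0 : Gross1991_heegnerPoint_sub_ratTorsion_mem_E0) (h372 : prop37_2_frobeniusCongruence)
    (hM3 : ∀ (W : WeierstrassCurve ℚ) [W.IsElliptic] [W.IsGloballyMinimal] (N : ℕ) [NeZero N],
      ClassO6 W 3 → W.HasSurjectiveModNGaloisRep 3 → W.analyticRank = 1 → W.conductorNorm ℤ = N →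
      ∀ (W₀ : WeierstrassCurve ℚ) [W₀.IsElliptic] [W₀.IsGloballyMinimal] (D₀ : ModularParametrizationData W₀ N),
        W.IsIsogenous W₀ → (∀ z ∈ D₀.L.lattice, ∃ w ∈ periodLattice D₀.f, z = D₀.c * w) → ¬ (3 : ℤ) ∣ D₀.c)
    (hJmF : ∀ (W : WeierstrassCurve ℚ) [W.IsElliptic] [W.IsGloballyMinimal] (N : ℕ) [NeZero N] (K : Type)
      [Field K] [NumberField K] (Dt : ModularParametrizationData W N)
      (H : HeegnerDatum N (NumberField.discr K)) (ι : K →+* ℂ) (P : (W.baseChange K).toAffine.Point),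
      ClassO6 W 3 → W.HasSurjectiveModNGaloisRep 3 → W.analyticRank = 1 → W.conductorNorm ℤ = N →
      IsImaginaryQuadratic K → SatisfiesHeegnerHypothesis N K →
      (W.quadraticTwist (NumberField.discr K : ℚ)).entireLFunction 1 ≠ 0 →
      WeierstrassCurve.Affine.Point.map ι.toRatAlgHom P = heegnerPointComplex Dt H →
      ¬ IsOfFinAddOrder P → Odd (NumberField.discr K) → NumberField.discr K ≠ -3 →
      ¬ (3 : ℤ) ∣ Dt.c →
      (∀ (q : ℕ) [Fact q.Prime], q ∣ N →
        padicValNat 3 ((W.baseChange ℚ_[q]).localTamagawaNumber ℤ_[q]) <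
          padicValNat 3 W.tamagawaProduct + padicValNat 3 Dt.c.natAbs) →
      ∀ (s' : ℕ), s' ≤ padicValNat 3 W.tamagawaProduct + padicValNat 3 Dt.c.natAbs →
        ∀ (n : ℕ) (d : KolyvaginHeegnerData Dt H.β ι n), Squarefree n →
          (∀ ℓ ∈ n.primeFactors, Zhang2014.IsKolyvaginPrime N W K 3 ℓ ∧
            s' ≤ Zhang2014.kolyvaginIndex W 3 ℓ) → Koly.PDiv d 3 s') :
    WildSigmaDivisibilityAtThreeMultiCarrier :=
  wildSigmaDivisibilityAtThreeMultiCarrier_of_flatMultiCarrier_of_maninThree_of_threePrintFacts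
    (fun K _ _ ↦ poitouTate_conj_of_selmerComplementCanonical K (hSC K)) hE0 h372 hM3 hJmF

/-! ## §3 Cremona's range: J‴'s conclusion frame-wise from E0 + 3.7 (2) + Cremona + `stub_flatMultiCarrier` -/

/-- **On Cremona's range `N ≤ 500000` (⊇ every census class of row 2·3@3): J‴'s conclusion at every frame of the cell ⟸ E0 + 3.7 (2)
+ Cremona's `|c₀| = 1` + `stub_flatMultiCarrier`** and the canonical family's complement property (`hSC`) — p621905's
`sigma_at_of_threePrintFacts_of_flatMultiCarrier_of_level_le_500000` with `hPT` fed by §0; NO Manin hypothesis, NO modularity fact.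
CONDITIONAL; nothing asserted. [cite: Jetchev2008, Thm. 1.4 and Conj. 1.3 (p. 812)] [cite: CesnaviciusNeururerSaha2023, §1 p. 574 and ref. [Cre22]]
[cite: GrossLMS1991, Prop. 3.7 (2) and §6] -/
theorem sigma_at_of_twoPrintFacts_of_flatMultiCarrier_of_level_le_500000_of_selmerComplementCanonical
    (hSC : ∀ (K : Type) [Field K] [NumberField K] (n : ℕ) [NeZero n], (LocalInvariants.canonical K n).SelmerComplement)
    (hE0 : Gross1991_heegnerPoint_sub_ratTorsion_mem_E0) (h372 : prop37_2_frobeniusCongruence)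
    (h500 : cremona_abs_maninConstant_eq_one_of_level_le_500000)
    (hJmF : ∀ (W : WeierstrassCurve ℚ) [W.IsElliptic] [W.IsGloballyMinimal] (N : ℕ) [NeZero N] (K : Type)
      [Field K] [NumberField K] (Dt : ModularParametrizationData W N)
      (H : HeegnerDatum N (NumberField.discr K)) (ι : K →+* ℂ) (P : (W.baseChange K).toAffine.Point),
      ClassO6 W 3 → W.HasSurjectiveModNGaloisRep 3 → W.analyticRank = 1 → W.conductorNorm ℤ = N →
      IsImaginaryQuadratic K → SatisfiesHeegnerHypothesis N K →
      (W.quadraticTwist (NumberField.discr K : ℚ)).entireLFunction 1 ≠ 0 →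
      WeierstrassCurve.Affine.Point.map ι.toRatAlgHom P = heegnerPointComplex Dt H →
      ¬ IsOfFinAddOrder P → Odd (NumberField.discr K) → NumberField.discr K ≠ -3 →
      ¬ (3 : ℤ) ∣ Dt.c →
      (∀ (q : ℕ) [Fact q.Prime], q ∣ N →
        padicValNat 3 ((W.baseChange ℚ_[q]).localTamagawaNumber ℤ_[q]) <
          padicValNat 3 W.tamagawaProduct + padicValNat 3 Dt.c.natAbs) →
      ∀ (s' : ℕ), s' ≤ padicValNat 3 W.tamagawaProduct + padicValNat 3 Dt.c.natAbs →
        ∀ (n : ℕ) (d : KolyvaginHeegnerData Dt H.β ι n), Squarefree n →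
          (∀ ℓ ∈ n.primeFactors, Zhang2014.IsKolyvaginPrime N W K 3 ℓ ∧
            s' ≤ Zhang2014.kolyvaginIndex W 3 ℓ) → Koly.PDiv d 3 s')
    (W : WeierstrassCurve ℚ) [W.IsElliptic] [W.IsGloballyMinimal] (N : ℕ) [NeZero N] (K : Type)
    [Field K] [NumberField K] (Dt : ModularParametrizationData W N)
    (H : HeegnerDatum N (NumberField.discr K)) (ι : K →+* ℂ) (P : (W.baseChange K).toAffine.Point)
    (hO6 : ClassO6 W 3) (hsurj : W.HasSurjectiveModNGaloisRep 3) (hr : W.analyticRank = 1) (hN : W.conductorNorm ℤ = N)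
    (hK : IsImaginaryQuadratic K) (hHH : SatisfiesHeegnerHypothesis N K)
    (hL : (W.quadraticTwist (NumberField.discr K : ℚ)).entireLFunction 1 ≠ 0)
    (hP : WeierstrassCurve.Affine.Point.map ι.toRatAlgHom P = heegnerPointComplex Dt H)
    (hnt : ¬ IsOfFinAddOrder P) (hodd : Odd (NumberField.discr K)) (h3 : NumberField.discr K ≠ -3)
    (hN500 : N ≤ 500000) :
    ∀ (s' : ℕ), s' ≤ padicValNat 3 W.tamagawaProduct + padicValNat 3 Dt.c.natAbs →
      ∀ (n : ℕ) (d : KolyvaginHeegnerData Dt H.β ι n), Squarefree n →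
        (∀ ℓ ∈ n.primeFactors, Zhang2014.IsKolyvaginPrime N W K 3 ℓ ∧
          s' ≤ Zhang2014.kolyvaginIndex W 3 ℓ) → Koly.PDiv d 3 s' :=
  sigma_at_of_threePrintFacts_of_flatMultiCarrier_of_level_le_500000
    (fun K _ _ ↦ poitouTate_conj_of_selmerComplementCanonical K (hSC K)) hE0 h372 h500 hJmF
    W N K Dt H ι P hO6 hsurj hr hN hK hHH hL hP hnt hodd h3 hN500

/-! ## §4 UNCONDITIONAL IN THE DUALITY INPUT — `selmerComplement_canonical_holds` (cell bsd-schneider Route A) plugged in -/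

/-- **Jetchev's max-form σ-divisibility at `3 ∣ N` under `ρ̄₃` onto (the consequent of item 25897) ⟸ Gross 1991 E0 + Prop. 3.7 (2)
ONLY** — §1 with the duality input discharged. CONDITIONAL on the two Gross primitives; nothing asserted about any curve unconditionally.
[cite: Jetchev2008, Thm. 1.4 (p. 812), Thm. 5.1] [cite: GrossLMS1991, Prop. 3.7 (2) p. 240 and §6 p. 245] -/
theorem jetchevMaxModThree_of_twoPrintFacts
    (hE0 : Gross1991_heegnerPoint_sub_ratTorsion_mem_E0) (h372 : prop37_2_frobeniusCongruence) :
    ∀ (W : WeierstrassCurve ℚ) [W.IsElliptic] [W.IsGloballyMinimal] (N : ℕ) [NeZero N] (K : Type) [Field K] [NumberField K]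
      (Dt : ModularParametrizationData W N) (H : HeegnerDatum N (NumberField.discr K)) (ι : K →+* ℂ)
      (P : (W.baseChange K).toAffine.Point),
      ClassO6 W 3 → W.HasSurjectiveModNGaloisRep 3 → W.analyticRank = 1 → W.conductorNorm ℤ = N →
      IsImaginaryQuadratic K → SatisfiesHeegnerHypothesis N K →
      (W.quadraticTwist (NumberField.discr K : ℚ)).entireLFunction 1 ≠ 0 →
      WeierstrassCurve.Affine.Point.map ι.toRatAlgHom P = heegnerPointComplex Dt H →
      ¬ IsOfFinAddOrder P → Odd (NumberField.discr K) → NumberField.discr K ≠ -3 →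
      ∀ (q : ℕ) [Fact q.Prime], q ∣ N →
        ∀ (s' : ℕ), s' ≤ padicValNat 3 ((W.baseChange ℚ_[q]).localTamagawaNumber ℤ_[q]) →
          ∀ (n : ℕ) (d : KolyvaginHeegnerData Dt H.β ι n), Squarefree n →
            (∀ ℓ ∈ n.primeFactors, Zhang2014.IsKolyvaginPrime N W K 3 ℓ ∧ s' ≤ Zhang2014.kolyvaginIndex W 3 ℓ) →
              Koly.PDiv d 3 s' :=
  jetchevMaxModThree_of_twoPrintFacts_of_selmerComplementCanonical (fun K _ _ n _ ↦ selmerComplement_canonical_holds K n) hE0 h372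

/-- **J‴ (stmt-BirchSwinnertonDyer-25898) BY NAME ⟸ Gross 1991 E0 + Prop. 3.7 (2) + `stub_maninThree` + `stub_flatMultiCarrier`** —
the skeleton-v3 composition of line `birth` (`stub_printConj := E0 ∧ 3.7 (2)`; the Poitou–Tate conjunct of v2 is DISCHARGED by cell
bsd-schneider's `selmerComplement_canonical_holds`). CONDITIONAL on the two print facts and the two stubs; nothing asserted about any
curve unconditionally; BSD is not proved by this. [cite: Jetchev2008, Thm. 1.4 and Conj. 1.3 (p. 812)]
[cite: Buyukboduk2009TamagawaDefect, §4.2 Question 1] [cite: AgasheRibetStein2006, §2 and Thm. 2.7] [cite: GrossLMS1991, Prop. 3.7 (2) and §6] -/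
theorem wildSigmaDivisibilityAtThreeMultiCarrier_of_flatMultiCarrier_of_maninThree_of_twoPrintFacts
    (hE0 : Gross1991_heegnerPoint_sub_ratTorsion_mem_E0) (h372 : prop37_2_frobeniusCongruence)
    (hM3 : ∀ (W : WeierstrassCurve ℚ) [W.IsElliptic] [W.IsGloballyMinimal] (N : ℕ) [NeZero N],
      ClassO6 W 3 → W.HasSurjectiveModNGaloisRep 3 → W.analyticRank = 1 → W.conductorNorm ℤ = N →
      ∀ (W₀ : WeierstrassCurve ℚ) [W₀.IsElliptic] [W₀.IsGloballyMinimal] (D₀ : ModularParametrizationData W₀ N),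
        W.IsIsogenous W₀ → (∀ z ∈ D₀.L.lattice, ∃ w ∈ periodLattice D₀.f, z = D₀.c * w) → ¬ (3 : ℤ) ∣ D₀.c)
    (hJmF : ∀ (W : WeierstrassCurve ℚ) [W.IsElliptic] [W.IsGloballyMinimal] (N : ℕ) [NeZero N] (K : Type)
      [Field K] [NumberField K] (Dt : ModularParametrizationData W N)
      (H : HeegnerDatum N (NumberField.discr K)) (ι : K →+* ℂ) (P : (W.baseChange K).toAffine.Point),
      ClassO6 W 3 → W.HasSurjectiveModNGaloisRep 3 → W.analyticRank = 1 → W.conductorNorm ℤ = N →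
      IsImaginaryQuadratic K → SatisfiesHeegnerHypothesis N K →
      (W.quadraticTwist (NumberField.discr K : ℚ)).entireLFunction 1 ≠ 0 →
      WeierstrassCurve.Affine.Point.map ι.toRatAlgHom P = heegnerPointComplex Dt H →
      ¬ IsOfFinAddOrder P → Odd (NumberField.discr K) → NumberField.discr K ≠ -3 →
      ¬ (3 : ℤ) ∣ Dt.c →
      (∀ (q : ℕ) [Fact q.Prime], q ∣ N →
        padicValNat 3 ((W.baseChange ℚ_[q]).localTamagawaNumber ℤ_[q]) <
          padicValNat 3 W.tamagawaProduct + padicValNat 3 Dt.c.natAbs) →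
      ∀ (s' : ℕ), s' ≤ padicValNat 3 W.tamagawaProduct + padicValNat 3 Dt.c.natAbs →
        ∀ (n : ℕ) (d : KolyvaginHeegnerData Dt H.β ι n), Squarefree n →
          (∀ ℓ ∈ n.primeFactors, Zhang2014.IsKolyvaginPrime N W K 3 ℓ ∧
            s' ≤ Zhang2014.kolyvaginIndex W 3 ℓ) → Koly.PDiv d 3 s') :
    WildSigmaDivisibilityAtThreeMultiCarrier :=
  wildSigmaDivisibilityAtThreeMultiCarrier_of_flatMultiCarrier_of_maninThree_of_twoPrintFacts_of_selmerComplementCanonical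
    (fun K _ _ n _ ↦ selmerComplement_canonical_holds K n) hE0 h372 hM3 hJmF

/-- **On Cremona's range `N ≤ 500000` (⊇ every census class of row 2·3@3): J‴'s conclusion at every frame of the cell ⟸ Gross 1991 E0 +
Prop. 3.7 (2) + Cremona's `|c₀| = 1` + `stub_flatMultiCarrier`** — NO Manin hypothesis, NO modularity fact, NO duality input (§3 with
`selmerComplement_canonical_holds` plugged in). So on the census row the Kolyvagin column's research crux has EXACTLY ONE research
input (`stub_flatMultiCarrier`, tight with the rung by p623556) and THREE print inputs {E0, 3.7 (2), Cremona}. CONDITIONAL; nothing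
asserted about any curve unconditionally. [cite: Jetchev2008, Thm. 1.4 and Conj. 1.3 (p. 812)]
[cite: CesnaviciusNeururerSaha2023, §1 p. 574 and ref. [Cre22]] [cite: GrossLMS1991, Prop. 3.7 (2) and §6] -/
theorem sigma_at_of_twoPrintFacts_of_flatMultiCarrier_of_level_le_500000
    (hE0 : Gross1991_heegnerPoint_sub_ratTorsion_mem_E0) (h372 : prop37_2_frobeniusCongruence)
    (h500 : cremona_abs_maninConstant_eq_one_of_level_le_500000)
    (hJmF : ∀ (W : WeierstrassCurve ℚ) [W.IsElliptic] [W.IsGloballyMinimal] (N : ℕ) [NeZero N] (K : Type)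
      [Field K] [NumberField K] (Dt : ModularParametrizationData W N)
      (H : HeegnerDatum N (NumberField.discr K)) (ι : K →+* ℂ) (P : (W.baseChange K).toAffine.Point),
      ClassO6 W 3 → W.HasSurjectiveModNGaloisRep 3 → W.analyticRank = 1 → W.conductorNorm ℤ = N →
      IsImaginaryQuadratic K → SatisfiesHeegnerHypothesis N K →
      (W.quadraticTwist (NumberField.discr K : ℚ)).entireLFunction 1 ≠ 0 →
      WeierstrassCurve.Affine.Point.map ι.toRatAlgHom P = heegnerPointComplex Dt H →
      ¬ IsOfFinAddOrder P → Odd (NumberField.discr K) → NumberField.discr K ≠ -3 →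
      ¬ (3 : ℤ) ∣ Dt.c →
      (∀ (q : ℕ) [Fact q.Prime], q ∣ N →
        padicValNat 3 ((W.baseChange ℚ_[q]).localTamagawaNumber ℤ_[q]) <
          padicValNat 3 W.tamagawaProduct + padicValNat 3 Dt.c.natAbs) →
      ∀ (s' : ℕ), s' ≤ padicValNat 3 W.tamagawaProduct + padicValNat 3 Dt.c.natAbs →
        ∀ (n : ℕ) (d : KolyvaginHeegnerData Dt H.β ι n), Squarefree n →
          (∀ ℓ ∈ n.primeFactors, Zhang2014.IsKolyvaginPrime N W K 3 ℓ ∧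
            s' ≤ Zhang2014.kolyvaginIndex W 3 ℓ) → Koly.PDiv d 3 s')
    (W : WeierstrassCurve ℚ) [W.IsElliptic] [W.IsGloballyMinimal] (N : ℕ) [NeZero N] (K : Type)
    [Field K] [NumberField K] (Dt : ModularParametrizationData W N)
    (H : HeegnerDatum N (NumberField.discr K)) (ι : K →+* ℂ) (P : (W.baseChange K).toAffine.Point)
    (hO6 : ClassO6 W 3) (hsurj : W.HasSurjectiveModNGaloisRep 3) (hr : W.analyticRank = 1) (hN : W.conductorNorm ℤ = N)
    (hK : IsImaginaryQuadratic K) (hHH : SatisfiesHeegnerHypothesis N K)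
    (hL : (W.quadraticTwist (NumberField.discr K : ℚ)).entireLFunction 1 ≠ 0)
    (hP : WeierstrassCurve.Affine.Point.map ι.toRatAlgHom P = heegnerPointComplex Dt H)
    (hnt : ¬ IsOfFinAddOrder P) (hodd : Odd (NumberField.discr K)) (h3 : NumberField.discr K ≠ -3)
    (hN500 : N ≤ 500000) :
    ∀ (s' : ℕ), s' ≤ padicValNat 3 W.tamagawaProduct + padicValNat 3 Dt.c.natAbs →
      ∀ (n : ℕ) (d : KolyvaginHeegnerData Dt H.β ι n), Squarefree n →
        (∀ ℓ ∈ n.primeFactors, Zhang2014.IsKolyvaginPrime N W K 3 ℓ ∧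
          s' ≤ Zhang2014.kolyvaginIndex W 3 ℓ) → Koly.PDiv d 3 s' :=
  sigma_at_of_twoPrintFacts_of_flatMultiCarrier_of_level_le_500000_of_selmerComplementCanonical
    (fun K _ _ n _ ↦ selmerComplement_canonical_holds K n) hE0 h372 h500 hJmF
    W N K Dt H ι P hO6 hsurj hr hN hK hHH hL hP hnt hodd h3 hN500

end Summit.BirchSwinnertonDyer.BirchSwinnertonDyer.Theorems.WildSigmaDivisibilityAtThreeMultiCarrierOfTwoPrintFacts

end
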